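import Mathlib
import HarnessLib
import Summits.NavierStokesRegularity.NavierStokesRegularity.Theorems.PoloidalWindowDoorPoloidalWindowRigiditySymmetryGerms

/-!
# The quadratic door: `v₂` quadratic along horizontal lines on an open set of ONE slice ⇒ trivial

Seat ns-poloidal-K2-p2 g4 (stub-worker on crux K2 `PoloidalWindowRigidity` = stmt-NavierStokesRegularity-19708,
line lrc-jet v4, stub `stub_timeHeightShear`).  The formal-jet census of the stratum (TH) «∂₂v_b = μ(t,x₂)∂_b v₂»
(seat memo TH-STEP3.md, evidence on the crux item) found that (TH) contains explicit polynomial Navier–Stokes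
families (planar constant vorticity; axisymmetric `ω_θ = c r`) and that the jet of the planar family is
infinitesimally rigid, from weighted order 12 on, modulo deformations that keep `v₂` a QUADRATIC POLYNOMIAL along
horizontal lines.  This file is the tree transfer for the corresponding structural target
(TH-AFF) «the horizontal vorticity is affine on horizontal planes», in the weakest form the class needs:

* `deriv_eq_zero_of_iteratedDeriv_three_eq_zero` — a bounded real function whose third derivative vanishes
  identically has identically vanishing derivative (it is the quadratic `f 0 + f′(0)τ + cτ²/2`, and a bounded
  quadratic is constant);
* `eq_zero_of_horizontalCubic_eq_zero_on_open` — **THE QUADRATIC DOOR**: if ONE poloidal slice `s < 0` of a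
  profile of the route's Type-I class has `∂₀³ v₂ = 0` (third derivative of the vertical velocity along the
  horizontal lines in direction `e₀`) on a non-empty open set, then `v ≡ 0`.  Proof: the slice is real-analytic
  (tree `analyticOnNhd_slice`), so along every horizontal line through the open set the third derivative vanishes
  identically; the line restriction of `v₂` is bounded by the Type-I rate, hence has zero derivative; so
  `∂₀ v₂ = 0` on the open set and the tree's flat germ theorem
  `…SymmetryGerms.eq_zero_of_horizontalGradient_eq_zero_on_open` concludes;
* `nonflatLiouville_of_horizontalCubic_eq_zero_on_open` — the same as «not a backward singular point»;
* `eq_zero_of_horizontalCubicFDeriv_eq_zero_on_open` / `nonflatLiouville_of_horizontalCubicFDeriv_eq_zero_on_open` —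
  the same door with the hypothesis as the thrice ITERATED DIRECTIONAL DERIVATIVE `∂_{e₀}³ v₂ = 0` on `U` (the
  currency of the crux's normal-form files), via `hasDerivAt_lineRestrict`.
-/

set_option linter.dupNamespace false

namespace Summit.NavierStokesRegularity.NavierStokesRegularity.Theorems.PoloidalWindowDoorPoloidalWindowRigidityQuadraticDoor

open Set Function Filter Topology
open scoped RealInnerProductSpace InnerProductSpace
open Literature.Analysis Literature.Analysis.FluidPDE
open Summit.NavierStokesRegularity.NavierStokesRegularity.Theorems.LocalSineTubeDoorProfileAlignedWindowRigidityAncient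
open Summit.NavierStokesRegularity.NavierStokesRegularity.Theorems.PoloidalWindowDoorPoloidalWindowRigiditySymmetryGerms
open Summit.NavierStokesRegularity.NavierStokesRegularity.Theorems.PoloidalWindowDoorPoloidalWindowRigidityFlat

/-! ### One real variable: bounded with vanishing third derivative ⇒ constant -/

/-- A bounded `C³` function on `ℝ` whose third derivative vanishes identically has identically vanishing first
derivative: it equals the quadratic `f 0 + f′(0)τ + cτ²/2` with `c = f″(0)`, and a quadratic bounded on `ℝ` has
`c = 0` and `f′(0) = 0`. -/
theorem deriv_eq_zero_of_iteratedDeriv_three_eq_zero {f : ℝ → ℝ} (hf : ContDiff ℝ 3 f)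
    (h3 : ∀ τ, iteratedDeriv 3 f τ = 0) {K : ℝ} (hK : ∀ τ, |f τ| ≤ K) : ∀ τ, deriv f τ = 0 := by
  have hd2 : Differentiable ℝ (iteratedDeriv 2 f) :=
    hf.differentiable_iteratedDeriv 2 (by norm_cast)
  have hd1 : Differentiable ℝ (deriv f) := by
    rw [← iteratedDeriv_one]; exact hf.differentiable_iteratedDeriv 1 (by norm_cast)
  have hd0 : Differentiable ℝ f := hf.differentiable (by norm_cast)
  set c := iteratedDeriv 2 f 0 with hc
  -- `f″ ≡ c`
  have h2c : ∀ τ, iteratedDeriv 2 f τ = c := fun τ =>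
    is_const_of_deriv_eq_zero hd2 (fun x => by rw [← iteratedDeriv_succ]; exact h3 x) τ 0
  have hdd : ∀ τ, HasDerivAt (deriv f) c τ := fun τ => by
    have h := (hd1 τ).hasDerivAt
    have h2 : deriv (deriv f) τ = c := by
      rw [← h2c τ, iteratedDeriv_succ, iteratedDeriv_one]
    rwa [h2] at h
  -- `f′ τ = f′ 0 + c τ`
  set β := deriv f 0 with hβ
  have h1 : ∀ τ, deriv f τ = β + c * τ := by
    intro τ
    have hg : ∀ x, HasDerivAt (fun y => deriv f y - c * y) 0 x := fun x => by
      have h2 : HasDerivAt (fun y : ℝ => c * y) c x := by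
        simpa using (hasDerivAt_id x).const_mul c
      have h12 := (hdd x).sub h2
      rw [sub_self] at h12
      exact h12
    have hgd : Differentiable ℝ (fun y => deriv f y - c * y) := fun x => (hg x).differentiableAt
    have e : deriv f τ - c * τ = deriv f 0 - c * 0 := is_const_of_deriv_eq_zero hgd (fun x => (hg x).deriv) τ 0
    linarith
  -- `f τ = f 0 + β τ + c τ²/2`
  have h0 : ∀ τ, f τ = f 0 + β * τ + c * τ ^ 2 / 2 := by
    intro τ
    have hg : ∀ x, HasDerivAt (fun y => f y - (β * y + c * y ^ 2 / 2)) 0 x := fun x => by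
      have hp : HasDerivAt (fun y : ℝ => β * y + c * y ^ 2 / 2) (β + c * x) x := by
        have hp1 : HasDerivAt (fun y : ℝ => β * y) β x := by simpa using (hasDerivAt_id x).const_mul β
        have hp2 : HasDerivAt (fun y : ℝ => c * y ^ 2 / 2) (c * x) x := by
          have := ((hasDerivAt_pow 2 x).const_mul c).div_const 2
          refine this.congr_deriv ?_
          ring
        exact hp1.add hp2
      have := ((hd0 x).hasDerivAt).sub hp
      rw [h1 x, sub_self] at this
      exact this
    have hgd : Differentiable ℝ (fun y => f y - (β * y + c * y ^ 2 / 2)) := fun x => (hg x).differentiableAt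
    have e : f τ - (β * τ + c * τ ^ 2 / 2) = f 0 - (β * 0 + c * 0 ^ 2 / 2) :=
      is_const_of_deriv_eq_zero hgd (fun x => (hg x).deriv) τ 0
    norm_num at e
    linarith
  have hK0 : 0 ≤ K := (abs_nonneg _).trans (hK 0)
  -- boundedness kills `c` …
  have hc0 : c = 0 := by
    by_contra hne
    have hcpos : 0 < |c| := abs_pos.2 hne
    set M := 2 * K + 2 * |f 0| with hM
    have hM0 : 0 ≤ M := by positivity
    have hbound : ∀ τ, |c| * τ ^ 2 ≤ M := fun τ => by
      have e : c * τ ^ 2 = f τ + f (-τ) - 2 * f 0 := by rw [h0 τ, h0 (-τ)]; ring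
      have hb1 := abs_le.1 (hK τ)
      have hb2 := abs_le.1 (hK (-τ))
      have : |c * τ ^ 2| ≤ M := by
        rw [e, hM]
        exact abs_le.2 ⟨by linarith [hb1.1, hb2.1, le_abs_self (f 0)],
          by linarith [hb1.2, hb2.2, neg_abs_le (f 0)]⟩
      rwa [abs_mul, abs_pow, sq_abs] at this
    set τ₀ := M / |c| + 1 with hτ₀
    have hτ1 : 1 ≤ τ₀ := by rw [hτ₀]; linarith [div_nonneg hM0 hcpos.le]
    have hsq : τ₀ ≤ τ₀ ^ 2 := by nlinarith
    have h := hbound τ₀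
    have : |c| * τ₀ = M + |c| := by rw [hτ₀]; field_simp
    nlinarith [mul_le_mul_of_nonneg_left hsq hcpos.le]
  -- … and `β`
  have hβ0 : β = 0 := by
    by_contra hne
    have hbpos : 0 < |β| := abs_pos.2 hne
    have hbound : ∀ τ, |β| * |τ| ≤ K := fun τ => by
      have e : 2 * (β * τ) = f τ - f (-τ) := by rw [h0 τ, h0 (-τ), hc0]; ring
      have hb1 := abs_le.1 (hK τ)
      have hb2 := abs_le.1 (hK (-τ))
      have : |2 * (β * τ)| ≤ 2 * K := by
        rw [e]
        exact abs_le.2 ⟨by linarith [hb1.1, hb2.2], by linarith [hb1.2, hb2.1]⟩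
      rw [abs_mul, abs_mul, abs_two] at this
      linarith
    set τ₀ := K / |β| + 1 with hτ₀
    have hτpos : 0 < τ₀ := by rw [hτ₀]; linarith [div_nonneg hK0 hbpos.le]
    have h := hbound τ₀
    rw [abs_of_pos hτpos] at h
    have : |β| * τ₀ = K + |β| := by rw [hτ₀]; field_simp
    linarith
  intro τ
  rw [h1 τ, hβ0, hc0]; ring

/-! ### The door -/

variable {C : ℝ} {v : ℝ → EuclideanSpace ℝ (Fin 3) → EuclideanSpace ℝ (Fin 3)}

/-- **THE QUADRATIC DOOR (one slice, open set).**  Let `v` be a profile of the route's Type-I class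
(`‖v(t)‖ ≤ C/√(−t)`, continuous on the slab, Oseen-mild, divergence-free) whose slice `s < 0` is poloidal along
`e₃`.  If on a non-empty open set `U` of that slice the vertical velocity is QUADRATIC ALONG THE HORIZONTAL LINES in
direction `e₀` — the third derivative of `τ ↦ v₂(s, x + τe₀)` vanishes at `τ = 0` for every `x ∈ U` — then
`v ≡ 0`.  (Structural endgame for the stratum (TH) of the crux: the numerically observed jet collapse (TH-AFF)
«`v₂` quadratic on horizontal planes» would land here; no Liouville theorem is needed, only the Type-I bound.) -/
theorem eq_zero_of_horizontalCubic_eq_zero_on_open (hrate : HasTypeITimeDecay C v)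
    (hcont : ContinuousOn (uncurry v) (Iio (0 : ℝ) ×ˢ univ))
    (hmild : ∀ s t : ℝ, s < t → t < 0 → ∀ x,
      v t x = UnboundedOperators.heatExtension (v s) (t - s) x - oseenDuhamel 1 s v v t x)
    (hdiv : ∀ t < 0, VectorCalculus.IsDivFree (v t)) {s : ℝ} (hs : s < 0)
    (hpol : ∀ y, ⟪curl (v s) y, EuclideanSpace.single 2 1⟫_ℝ = 0)
    {U : Set (EuclideanSpace ℝ (Fin 3))} (hU : IsOpen U) (hne : U.Nonempty)
    (h3 : ∀ x ∈ U, iteratedDeriv 3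
      (fun τ : ℝ => v s (x + τ • EuclideanSpace.single 0 (1 : ℝ)) 2) 0 = 0) :
    ∀ t < 0, ∀ x, v t x = 0 := by
  set e₀ : EuclideanSpace ℝ (Fin 3) := EuclideanSpace.single 0 (1 : ℝ) with he₀
  have hbdd := bdd_of_hasTypeITimeDecay hrate
  have hA : AnalyticOnNhd ℝ (v s) univ := analyticOnNhd_slice hcont hbdd hmild hs
  -- the vertical component is analytic on the slice
  have hA2 : AnalyticOnNhd ℝ (fun y => v s y 2) univ := fun y _ =>
    ((EuclideanSpace.proj (𝕜 := ℝ) (2 : Fin 3)).analyticAt _).comp (hA y (mem_univ y))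
  refine eq_zero_of_horizontalGradient_eq_zero_on_open hrate hcont hmild hdiv hs hpol hU hne fun x hx => ?_
  -- the line restriction `f τ = v₂(s, x + τ e₀)`
  set f : ℝ → ℝ := fun τ => v s (x + τ • e₀) 2 with hf
  have hline : AnalyticOnNhd ℝ (fun τ : ℝ => x + τ • e₀) univ := fun τ _ =>
    analyticAt_const.add ((analyticAt_id).smul analyticAt_const)
  have hfA : AnalyticOnNhd ℝ f univ := fun τ _ =>
    (hA2 _ (mem_univ _)).comp (hline τ (mem_univ τ))
  have hfC : ContDiff ℝ 3 f := by
    have h := hfA.contDiffOn (n := 3) uniqueDiffOn_univ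
    exact contDiffOn_univ.1 h
  -- its third derivative is analytic and vanishes near `τ = 0`, hence everywhere
  have hF3A : AnalyticOnNhd ℝ (iteratedDeriv 3 f) univ := by
    rw [iteratedDeriv_eq_iterate]; exact hfA.iterated_deriv 3
  have hpre : IsOpen {τ : ℝ | x + τ • e₀ ∈ U} :=
    hU.preimage (continuous_const.add (continuous_id.smul continuous_const))
  have h0mem : (0 : ℝ) ∈ {τ : ℝ | x + τ • e₀ ∈ U} := by simpa using hx
  have hev : ∀ᶠ τ in 𝓝 (0 : ℝ), iteratedDeriv 3 f τ = 0 := by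
    filter_upwards [hpre.mem_nhds h0mem] with τ hτ
    have h := h3 (x + τ • e₀) hτ
    have hshift : (fun τ' : ℝ => v s (x + τ • e₀ + τ' • e₀) 2) = fun τ' => f (τ' + τ) := by
      funext τ'
      simp only [hf]
      rw [show x + τ • e₀ + τ' • e₀ = x + (τ' + τ) • e₀ by rw [add_smul]; abel]
    rw [hshift, iteratedDeriv_comp_add_const 3 f τ] at h
    simpa using h
  have hF3 : ∀ τ, iteratedDeriv 3 f τ = 0 := fun τ => by
    have h := hF3A.eqOn_zero_of_preconnected_of_eventuallyEq_zero isPreconnected_univ (mem_univ 0) hev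
    exact h (mem_univ τ)
  -- the line restriction is bounded by the Type-I rate
  have hK : ∀ τ, |f τ| ≤ C / Real.sqrt (-s) := fun τ => by
    have h1 : |v s (x + τ • e₀) 2| ≤ ‖v s (x + τ • e₀)‖ := by
      have h := abs_real_inner_le_norm (v s (x + τ • e₀)) (EuclideanSpace.single 2 (1 : ℝ))
      rw [EuclideanSpace.inner_single_right] at h
      simpa using h
    exact h1.trans (hrate s hs _)
  have hd : deriv f 0 = 0 := deriv_eq_zero_of_iteratedDeriv_three_eq_zero hfC hF3 hK 0
  -- and `f′(0) = ∂₀ v₂(s, x)`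
  have hdf : HasDerivAt f (fderiv ℝ (v s) x e₀ 2) 0 := by
    have hv : HasFDerivAt (v s) (fderiv ℝ (v s) x) (x + (0 : ℝ) • e₀) := by
      simpa using ((hA x (mem_univ x)).differentiableAt).hasFDerivAt
    have hl : HasDerivAt (fun τ : ℝ => x + τ • e₀) e₀ 0 := by
      simpa using ((hasDerivAt_id (0 : ℝ)).smul_const e₀).const_add x
    have hcomp := hv.comp_hasDerivAt (0 : ℝ) hl
    have h2 : HasDerivAt (fun τ : ℝ => (v s (x + τ • e₀)) 2) (fderiv ℝ (v s) x e₀ 2) 0 :=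
      ((EuclideanSpace.proj (𝕜 := ℝ) (2 : Fin 3)).hasFDerivAt.comp_hasDerivAt (0 : ℝ) hcomp)
    exact h2
  rw [← hdf.deriv, hd]

/-- **The quadratic door, «not backward-singular» form.** -/
theorem nonflatLiouville_of_horizontalCubic_eq_zero_on_open (hrate : HasTypeITimeDecay C v)
    (hcont : ContinuousOn (uncurry v) (Iio (0 : ℝ) ×ˢ univ))
    (hmild : ∀ s t : ℝ, s < t → t < 0 → ∀ x,
      v t x = UnboundedOperators.heatExtension (v s) (t - s) x - oseenDuhamel 1 s v v t x)
    (hdiv : ∀ t < 0, VectorCalculus.IsDivFree (v t)) {s : ℝ} (hs : s < 0)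
    (hpol : ∀ y, ⟪curl (v s) y, EuclideanSpace.single 2 1⟫_ℝ = 0)
    {U : Set (EuclideanSpace ℝ (Fin 3))} (hU : IsOpen U) (hne : U.Nonempty)
    (h3 : ∀ x ∈ U, iteratedDeriv 3
      (fun τ : ℝ => v s (x + τ • EuclideanSpace.single 0 (1 : ℝ)) 2) 0 = 0) :
    ¬ IsBackwardSingularPoint v 0 :=
  not_backwardSingular_of_zero (eq_zero_of_horizontalCubic_eq_zero_on_open hrate hcont hmild hdiv hs hpol hU hne h3)

/-! ### Directional-derivative form

The structural statement (TH-AFF) is naturally produced as the vanishing of the third DIRECTIONAL derivative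
`∂_{e₀}∂_{e₀}∂_{e₀} v₂` (iterated `fderiv`), which is the currency of the crux's normal-form files; the next two
theorems convert that form into the line-restriction form of the door. -/

/-- Along a line `σ ↦ x + σ • e`, the derivative of the restriction of a differentiable `g` is the directional
derivative `Dg[e]`. -/
theorem hasDerivAt_lineRestrict {g : EuclideanSpace ℝ (Fin 3) → ℝ} (x e : EuclideanSpace ℝ (Fin 3)) (τ : ℝ)
    (hg : DifferentiableAt ℝ g (x + τ • e)) :
    HasDerivAt (fun σ : ℝ => g (x + σ • e)) (fderiv ℝ g (x + τ • e) e) τ := by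
  have hl : HasDerivAt (fun σ : ℝ => x + σ • e) e τ := by
    simpa using ((hasDerivAt_id τ).smul_const e).const_add x
  exact hg.hasFDerivAt.comp_hasDerivAt τ hl

/-- **The quadratic door, directional-derivative form.**  Same as `eq_zero_of_horizontalCubic_eq_zero_on_open`,
with the hypothesis stated as the vanishing on the open set `U` of the thrice iterated directional derivative
`y ↦ D(y ↦ D(y ↦ D v(s)(y)[e₀]·e₃)(y)[e₀])(y)[e₀]` of the vertical velocity along `e₀`. -/
theorem eq_zero_of_horizontalCubicFDeriv_eq_zero_on_open (hrate : HasTypeITimeDecay C v)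
    (hcont : ContinuousOn (uncurry v) (Iio (0 : ℝ) ×ˢ univ))
    (hmild : ∀ s t : ℝ, s < t → t < 0 → ∀ x,
      v t x = UnboundedOperators.heatExtension (v s) (t - s) x - oseenDuhamel 1 s v v t x)
    (hdiv : ∀ t < 0, VectorCalculus.IsDivFree (v t)) {s : ℝ} (hs : s < 0)
    (hpol : ∀ y, ⟪curl (v s) y, EuclideanSpace.single 2 1⟫_ℝ = 0)
    {U : Set (EuclideanSpace ℝ (Fin 3))} (hU : IsOpen U) (hne : U.Nonempty)
    (h3 : ∀ x ∈ U, fderiv ℝ (fun y => fderiv ℝ (fun y' => fderiv ℝ (v s) y' (EuclideanSpace.single 0 (1 : ℝ)) 2) y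
      (EuclideanSpace.single 0 (1 : ℝ))) x (EuclideanSpace.single 0 (1 : ℝ)) = 0) :
    ∀ t < 0, ∀ x, v t x = 0 := by
  set e₀ : EuclideanSpace ℝ (Fin 3) := EuclideanSpace.single 0 (1 : ℝ) with he₀
  have hbdd := bdd_of_hasTypeITimeDecay hrate
  have hA : AnalyticOnNhd ℝ (v s) univ := analyticOnNhd_slice hcont hbdd hmild hs
  -- the three functions `g₀ = v₂`, `g₁ = ∂_{e₀} v₂`, `g₂ = ∂_{e₀} g₁` are analytic, hence differentiable
  set g₀ : EuclideanSpace ℝ (Fin 3) → ℝ := fun y => v s y 2 with hg₀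
  set g₁ : EuclideanSpace ℝ (Fin 3) → ℝ := fun y => fderiv ℝ (v s) y e₀ 2 with hg₁
  set g₂ : EuclideanSpace ℝ (Fin 3) → ℝ := fun y => fderiv ℝ g₁ y e₀ with hg₂
  have hA0 : AnalyticOnNhd ℝ g₀ univ := fun y _ =>
    ((EuclideanSpace.proj (𝕜 := ℝ) (2 : Fin 3)).analyticAt _).comp (hA y (mem_univ y))
  have hA1v : AnalyticOnNhd ℝ (fun y => fderiv ℝ (v s) y e₀) univ :=
    analyticOnNhd_fderiv_apply hA (fun y _ => analyticAt_const)
  have hA1 : AnalyticOnNhd ℝ g₁ univ := fun y _ =>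
    ((EuclideanSpace.proj (𝕜 := ℝ) (2 : Fin 3)).analyticAt _).comp (hA1v y (mem_univ y))
  have hA2 : AnalyticOnNhd ℝ g₂ univ := analyticOnNhd_fderiv_apply hA1 (fun y _ => analyticAt_const)
  -- `D g₀ [e₀] = g₁`
  have hg01 : ∀ y, fderiv ℝ g₀ y e₀ = g₁ y := fun y => by
    have hv : HasFDerivAt (v s) (fderiv ℝ (v s) y) y := ((hA y (mem_univ y)).differentiableAt).hasFDerivAt
    have h := ((EuclideanSpace.proj (𝕜 := ℝ) (2 : Fin 3)).hasFDerivAt.comp y hv).fderiv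
    have h' : fderiv ℝ g₀ y = (EuclideanSpace.proj (𝕜 := ℝ) (2 : Fin 3) :
        EuclideanSpace ℝ (Fin 3) →L[ℝ] ℝ).comp (fderiv ℝ (v s) y) := h
    rw [h']; rfl
  refine eq_zero_of_horizontalCubic_eq_zero_on_open hrate hcont hmild hdiv hs hpol hU hne fun x hx => ?_
  -- line restriction and its three derivatives
  set f : ℝ → ℝ := fun τ => v s (x + τ • e₀) 2 with hf
  have hd1 : deriv f = fun τ => g₁ (x + τ • e₀) := by
    funext τ
    have h := hasDerivAt_lineRestrict (g := g₀) x e₀ τ ((hA0 _ (mem_univ _)).differentiableAt)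
    rw [hg01] at h
    exact h.deriv
  have hd2 : deriv (deriv f) = fun τ => g₂ (x + τ • e₀) := by
    rw [hd1]; funext τ
    exact (hasDerivAt_lineRestrict (g := g₁) x e₀ τ ((hA1 _ (mem_univ _)).differentiableAt)).deriv
  have hd3 : deriv (deriv (deriv f)) 0 = fderiv ℝ g₂ x e₀ := by
    rw [hd2]
    have h := (hasDerivAt_lineRestrict (g := g₂) x e₀ 0 ((hA2 _ (mem_univ _)).differentiableAt)).deriv
    simpa using h
  have hi : iteratedDeriv 3 f 0 = deriv (deriv (deriv f)) 0 := by
    rw [show (3 : ℕ) = 0 + 1 + 1 + 1 from rfl, iteratedDeriv_succ, iteratedDeriv_succ, iteratedDeriv_succ,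
      iteratedDeriv_zero]
  rw [hi, hd3]
  exact h3 x hx

/-- **The quadratic door, directional-derivative form, «not backward-singular».** -/
theorem nonflatLiouville_of_horizontalCubicFDeriv_eq_zero_on_open (hrate : HasTypeITimeDecay C v)
    (hcont : ContinuousOn (uncurry v) (Iio (0 : ℝ) ×ˢ univ))
    (hmild : ∀ s t : ℝ, s < t → t < 0 → ∀ x,
      v t x = UnboundedOperators.heatExtension (v s) (t - s) x - oseenDuhamel 1 s v v t x)
    (hdiv : ∀ t < 0, VectorCalculus.IsDivFree (v t)) {s : ℝ} (hs : s < 0)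
    (hpol : ∀ y, ⟪curl (v s) y, EuclideanSpace.single 2 1⟫_ℝ = 0)
    {U : Set (EuclideanSpace ℝ (Fin 3))} (hU : IsOpen U) (hne : U.Nonempty)
    (h3 : ∀ x ∈ U, fderiv ℝ (fun y => fderiv ℝ (fun y' => fderiv ℝ (v s) y' (EuclideanSpace.single 0 (1 : ℝ)) 2) y
      (EuclideanSpace.single 0 (1 : ℝ))) x (EuclideanSpace.single 0 (1 : ℝ)) = 0) :
    ¬ IsBackwardSingularPoint v 0 :=
  not_backwardSingular_of_zero
    (eq_zero_of_horizontalCubicFDeriv_eq_zero_on_open hrate hcont hmild hdiv hs hpol hU hne h3)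

end Summit.NavierStokesRegularity.NavierStokesRegularity.Theorems.PoloidalWindowDoorPoloidalWindowRigidityQuadraticDoor
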